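import Summits.Ventures.PackingBounds.Configurations.E8Frame

/-!
# Glue vectors of a `D₄`-frame in a `240`-point kissing configuration of `ℝ⁸` (Bannai–Sloane, step (ii), part 4)

Framing: lottery ticket; floor = certified bounds/negative ranges. Venture `PackingBounds` (cell
`pub-packcert`, seat `pub-packcert-energy`).

Let `C ⊂ S⁷` be any kissing configuration with `|C| = 240` and let `a, b, c, e ∈ C` be pairwise orthogonal
with `d = (a + b + c + e)/2 ∈ C` (`E8Frame.exists_frame`). The **pattern class**
`P(a,b;c,e) = {y ∈ C : ⟨a,y⟩ = ⟨b,y⟩ = 1/2, ⟨c,y⟩ = ⟨e,y⟩ = 0}` has at least `8` elements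
(`eight_le_card_pattern`): of the `12` points with `⟨a,y⟩ = ⟨b,y⟩ = 1/2` (`E8PairCounts.card_half_half`)
at most `4` have `(⟨c,y⟩, ⟨e,y⟩) ≠ (0,0)`, because Bessel's inequality and the integrality of `2⟨d,y⟩`
force `(⟨c,y⟩, ⟨e,y⟩) ∈ {±1/2}²` for those, and such a point is determined by its four coordinates
(Bessel equality). Consequently (`exists_four`) there are `y₁, y₂, y₃, y₄ ∈ P(a,b;c,e)` with pairwise inner
products `1/2`, i.e. whose glue components `yᵢ - (a+b)/2` (norm² `1/2`, orthogonal to the frame) are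
pairwise orthogonal — half of the second `D₄` of `E₈ ⊃ D₄ ⊕ D₄`.

## References
* E. Bannai, N. J. A. Sloane, Canad. J. Math. 33 (1981) 437–449 (= Conway–Sloane, *SPLAG*, Ch. 14, Thm. 7–8). [`ConwaySloane1999`]
-/

namespace Summit.Ventures.PackingBounds.Config.E8Glue

open Finset

/-- Orthonormal expansion with four orthonormal vectors: `‖y - Σ ⟨vᵢ,y⟩ vᵢ‖² = ‖y‖² - Σ ⟨vᵢ,y⟩²`. -/
theorem inner_self_sub_comb {a b c e y : EuclideanSpace ℝ (Fin 8)}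
    (haa : inner ℝ a a = 1) (hbb : inner ℝ b b = 1) (hcc : inner ℝ c c = 1) (hee : inner ℝ e e = 1)
    (hab : inner ℝ a b = 0) (hac : inner ℝ a c = 0) (hae : inner ℝ a e = 0) (hbc : inner ℝ b c = 0)
    (hbe : inner ℝ b e = 0) (hce : inner ℝ c e = 0) :
    inner ℝ (y - (inner ℝ a y • a + inner ℝ b y • b + inner ℝ c y • c + inner ℝ e y • e))
        (y - (inner ℝ a y • a + inner ℝ b y • b + inner ℝ c y • c + inner ℝ e y • e)) =
      inner ℝ y y - (inner ℝ a y ^ 2 + inner ℝ b y ^ 2 + inner ℝ c y ^ 2 + inner ℝ e y ^ 2) := by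
  have hba : inner ℝ b a = 0 := by rw [real_inner_comm]; exact hab
  have hca : inner ℝ c a = 0 := by rw [real_inner_comm]; exact hac
  have hea : inner ℝ e a = 0 := by rw [real_inner_comm]; exact hae
  have hcb : inner ℝ c b = 0 := by rw [real_inner_comm]; exact hbc
  have heb : inner ℝ e b = 0 := by rw [real_inner_comm]; exact hbe
  have hec : inner ℝ e c = 0 := by rw [real_inner_comm]; exact hce
  have hya : inner ℝ y a = inner ℝ a y := real_inner_comm _ _
  have hyb : inner ℝ y b = inner ℝ b y := real_inner_comm _ _
  have hyc : inner ℝ y c = inner ℝ c y := real_inner_comm _ _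
  have hye : inner ℝ y e = inner ℝ e y := real_inner_comm _ _
  simp only [inner_sub_left, inner_sub_right, inner_add_left, inner_add_right, inner_smul_left,
    inner_smul_right, haa, hbb, hcc, hee, hab, hac, hae, hbc, hbe, hce, hba, hca, hea, hcb, heb, hec,
    hya, hyb, hyc, hye, RCLike.conj_to_real]
  ring

/-- **Bessel** for four orthonormal vectors: `Σ ⟨vᵢ,y⟩² ≤ ‖y‖²`. -/
theorem sum_sq_le {a b c e y : EuclideanSpace ℝ (Fin 8)}
    (haa : inner ℝ a a = 1) (hbb : inner ℝ b b = 1) (hcc : inner ℝ c c = 1) (hee : inner ℝ e e = 1)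
    (hab : inner ℝ a b = 0) (hac : inner ℝ a c = 0) (hae : inner ℝ a e = 0) (hbc : inner ℝ b c = 0)
    (hbe : inner ℝ b e = 0) (hce : inner ℝ c e = 0) :
    inner ℝ a y ^ 2 + inner ℝ b y ^ 2 + inner ℝ c y ^ 2 + inner ℝ e y ^ 2 ≤ inner ℝ y y := by
  have h := inner_self_sub_comb (y := y) haa hbb hcc hee hab hac hae hbc hbe hce
  have h0 := real_inner_self_nonneg
    (x := y - (inner ℝ a y • a + inner ℝ b y • b + inner ℝ c y • c + inner ℝ e y • e))
  linarith

/-- **Bessel, equality case**: if `Σ ⟨vᵢ,y⟩² = ‖y‖²` then `y = Σ ⟨vᵢ,y⟩ vᵢ`. -/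
theorem eq_comb_of_sum_sq_eq {a b c e y : EuclideanSpace ℝ (Fin 8)}
    (haa : inner ℝ a a = 1) (hbb : inner ℝ b b = 1) (hcc : inner ℝ c c = 1) (hee : inner ℝ e e = 1)
    (hab : inner ℝ a b = 0) (hac : inner ℝ a c = 0) (hae : inner ℝ a e = 0) (hbc : inner ℝ b c = 0)
    (hbe : inner ℝ b e = 0) (hce : inner ℝ c e = 0)
    (h : inner ℝ a y ^ 2 + inner ℝ b y ^ 2 + inner ℝ c y ^ 2 + inner ℝ e y ^ 2 = inner ℝ y y) :
    y = inner ℝ a y • a + inner ℝ b y • b + inner ℝ c y • c + inner ℝ e y • e := by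
  have h' := inner_self_sub_comb (y := y) haa hbb hcc hee hab hac hae hbc hbe hce
  rw [← h, sub_self, real_inner_self_eq_norm_sq, sq_eq_zero_iff, norm_eq_zero, sub_eq_zero] at h'
  exact h'

section config

variable {C : Finset (EuclideanSpace ℝ (Fin 8))} (h1 : ∀ x ∈ C, ‖x‖ = 1)
  (h2 : ∀ x ∈ C, ∀ y ∈ C, x ≠ y → inner ℝ x y ≤ 1 / 2) (hcard : C.card = 240)
include h1 h2 hcard

/-- For a `D₄`-frame `a, b, c, e` (with `d = (a+b+c+e)/2 ∈ C`), a point `y ∈ C` with `⟨a,y⟩ = ⟨b,y⟩ = 1/2`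
and `(⟨c,y⟩, ⟨e,y⟩) ≠ (0, 0)` has `⟨c,y⟩, ⟨e,y⟩ ∈ {±1/2}` (Bessel + integrality of `2⟨d,y⟩`). -/
theorem cross_values {a b c e d y : EuclideanSpace ℝ (Fin 8)} (ha : a ∈ C) (hb : b ∈ C) (hc : c ∈ C)
    (he : e ∈ C) (hd : d ∈ C)
    (hab : inner ℝ a b = 0) (hac : inner ℝ a c = 0) (hae : inner ℝ a e = 0) (hbc : inner ℝ b c = 0)
    (hbe : inner ℝ b e = 0) (hce : inner ℝ c e = 0) (hdsum : d = (1 / 2 : ℝ) • (a + b + c + e))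
    (hy : y ∈ C) (hay : inner ℝ a y = 1 / 2) (hby : inner ℝ b y = 1 / 2)
    (hne : ¬(inner ℝ c y = 0 ∧ inner ℝ e y = 0)) :
    (inner ℝ c y = 1 / 2 ∨ inner ℝ c y = -1 / 2) ∧ (inner ℝ e y = 1 / 2 ∨ inner ℝ e y = -1 / 2) := by
  have haa : inner ℝ a a = 1 := by rw [real_inner_self_eq_norm_sq, h1 a ha, one_pow]
  have hbb : inner ℝ b b = 1 := by rw [real_inner_self_eq_norm_sq, h1 b hb, one_pow]
  have hcc : inner ℝ c c = 1 := by rw [real_inner_self_eq_norm_sq, h1 c hc, one_pow]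
  have hee : inner ℝ e e = 1 := by rw [real_inner_self_eq_norm_sq, h1 e he, one_pow]
  have hyy : inner ℝ y y = 1 := by rw [real_inner_self_eq_norm_sq, h1 y hy, one_pow]
  have hB := sum_sq_le (y := y) haa hbb hcc hee hab hac hae hbc hbe hce
  rw [hay, hby, hyy] at hB
  -- parity: `⟨d,y⟩ = (1 + ⟨c,y⟩ + ⟨e,y⟩)/2` takes one of the five values
  have hdy : inner ℝ d y = (1 / 2 : ℝ) * (1 / 2 + 1 / 2 + inner ℝ c y + inner ℝ e y) := by
    rw [hdsum, inner_smul_left, inner_add_left, inner_add_left, inner_add_left, hay, hby]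
    simp
  have hpar := E8Closure.inner_cases h1 h2 hcard hd hy
  rw [hdy] at hpar
  have hc5 := E8Closure.inner_cases h1 h2 hcard hc hy
  have he5 := E8Closure.inner_cases h1 h2 hcard he hy
  -- exclude `±1` by Bessel
  have hc3 : inner ℝ c y = -1 / 2 ∨ inner ℝ c y = 0 ∨ inner ℝ c y = 1 / 2 := by
    rcases hc5 with h | h | h | h | h
    · exfalso; rw [h] at hB; nlinarith [sq_nonneg (inner ℝ e y)]
    · exfalso; rw [h] at hB; nlinarith [sq_nonneg (inner ℝ e y)]
    · exact Or.inl h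
    · exact Or.inr (Or.inl h)
    · exact Or.inr (Or.inr h)
  have he3 : inner ℝ e y = -1 / 2 ∨ inner ℝ e y = 0 ∨ inner ℝ e y = 1 / 2 := by
    rcases he5 with h | h | h | h | h
    · exfalso; rw [h] at hB; nlinarith [sq_nonneg (inner ℝ c y)]
    · exfalso; rw [h] at hB; nlinarith [sq_nonneg (inner ℝ c y)]
    · exact Or.inl h
    · exact Or.inr (Or.inl h)
    · exact Or.inr (Or.inr h)
  rcases hc3 with hc' | hc' | hc' <;> rcases he3 with he' | he' | he' <;>
    first
      | exact (hne ⟨hc', he'⟩).elim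
      | (rw [hc', he'] at hpar; norm_num at hpar; done)
      | (rw [hc', he']; norm_num)

/-- **The pattern class has at least `8` elements.** [cite: ConwaySloane1999, Ch. 14 Thm. 7] -/
theorem eight_le_card_pattern {a b c e d : EuclideanSpace ℝ (Fin 8)} (ha : a ∈ C) (hb : b ∈ C)
    (hc : c ∈ C) (he : e ∈ C) (hd : d ∈ C)
    (hab : inner ℝ a b = 0) (hac : inner ℝ a c = 0) (hae : inner ℝ a e = 0) (hbc : inner ℝ b c = 0)
    (hbe : inner ℝ b e = 0) (hce : inner ℝ c e = 0) (hdsum : d = (1 / 2 : ℝ) • (a + b + c + e)) :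
    8 ≤ (C.filter (fun y => inner ℝ a y = 1 / 2 ∧ inner ℝ b y = 1 / 2 ∧ inner ℝ c y = 0 ∧
      inner ℝ e y = 0)).card := by
  classical
  have haa : inner ℝ a a = 1 := by rw [real_inner_self_eq_norm_sq, h1 a ha, one_pow]
  have hbb : inner ℝ b b = 1 := by rw [real_inner_self_eq_norm_sq, h1 b hb, one_pow]
  have hcc : inner ℝ c c = 1 := by rw [real_inner_self_eq_norm_sq, h1 c hc, one_pow]
  have hee : inner ℝ e e = 1 := by rw [real_inner_self_eq_norm_sq, h1 e he, one_pow]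
  set S := C.filter (fun y => inner ℝ a y = 1 / 2 ∧ inner ℝ b y = 1 / 2) with hS
  have hS12 : S.card = 12 := E8PairCounts.card_half_half h1 h2 hcard ha hb hab
  have hPS : C.filter (fun y => inner ℝ a y = 1 / 2 ∧ inner ℝ b y = 1 / 2 ∧ inner ℝ c y = 0 ∧
      inner ℝ e y = 0) = S.filter (fun y => inner ℝ c y = 0 ∧ inner ℝ e y = 0) := by
    rw [hS, Finset.filter_filter]
    congr 1
    ext y
    tauto
  rw [hPS]
  have hsplit := Finset.card_filter_add_card_filter_not (s := S)
    (fun y => inner ℝ c y = 0 ∧ inner ℝ e y = 0)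
  -- the complement injects into the four sign patterns
  set T : Finset (ℝ × ℝ) := {((1 : ℝ) / 2, (1 : ℝ) / 2), (1 / 2, -1 / 2), (-1 / 2, 1 / 2), (-1 / 2, -1 / 2)}
    with hT
  have hT4 : T.card ≤ 4 := Finset.card_le_four
  have hmaps : ∀ y ∈ S.filter (fun y => ¬(inner ℝ c y = 0 ∧ inner ℝ e y = 0)),
      (fun y => (inner ℝ c y, inner ℝ e y)) y ∈ T := by
    intro y hy
    rw [Finset.mem_filter] at hy
    have hyS := Finset.mem_filter.mp hy.1
    obtain ⟨hc', he'⟩ := cross_values h1 h2 hcard ha hb hc he hd hab hac hae hbc hbe hce hdsum hyS.1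
      hyS.2.1 hyS.2.2 hy.2
    simp only [hT, Finset.mem_insert, Finset.mem_singleton, Prod.mk.injEq]
    rcases hc' with h | h <;> rcases he' with h' | h' <;> simp [h, h']
  have hinj : Set.InjOn (fun y => (inner ℝ c y, inner ℝ e y))
      (S.filter (fun y => ¬(inner ℝ c y = 0 ∧ inner ℝ e y = 0)) : Set (EuclideanSpace ℝ (Fin 8))) := by
    intro y hy y' hy' hφ
    rw [Finset.coe_filter, Set.mem_setOf_eq] at hy hy'
    have hyS := Finset.mem_filter.mp hy.1
    have hy'S := Finset.mem_filter.mp hy'.1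
    simp only [Prod.mk.injEq] at hφ
    obtain ⟨hc', he'⟩ := cross_values h1 h2 hcard ha hb hc he hd hab hac hae hbc hbe hce hdsum hyS.1
      hyS.2.1 hyS.2.2 hy.2
    have hyy : inner ℝ y y = 1 := by rw [real_inner_self_eq_norm_sq, h1 y hyS.1, one_pow]
    have hyy' : inner ℝ y' y' = 1 := by rw [real_inner_self_eq_norm_sq, h1 y' hy'S.1, one_pow]
    have hsq : inner ℝ c y ^ 2 = 1 / 4 ∧ inner ℝ e y ^ 2 = 1 / 4 := by
      constructor
      · rcases hc' with h | h <;> rw [h] <;> norm_num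
      · rcases he' with h | h <;> rw [h] <;> norm_num
    have ey := eq_comb_of_sum_sq_eq (y := y) haa hbb hcc hee hab hac hae hbc hbe hce
      (by rw [hyS.2.1, hyS.2.2, hsq.1, hsq.2, hyy]; norm_num)
    have ey' := eq_comb_of_sum_sq_eq (y := y') haa hbb hcc hee hab hac hae hbc hbe hce
      (by rw [hy'S.2.1, hy'S.2.2, ← hφ.1, ← hφ.2, hsq.1, hsq.2, hyy']; norm_num)
    rw [ey, ey', hyS.2.1, hyS.2.2, hy'S.2.1, hy'S.2.2, hφ.1, hφ.2]
  have hle := Finset.card_le_card_of_injOn _ hmaps hinj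
  omega

/-- A point of the pattern class not equal to `y` or `a + b - y` has inner product `1/2` with `y`. -/
theorem inner_eq_half_of_ne {a b y y' : EuclideanSpace ℝ (Fin 8)} (ha : a ∈ C) (hb : b ∈ C)
    (hab : inner ℝ a b = 0) (hy : y ∈ C) (hy' : y' ∈ C)
    (hay : inner ℝ a y = 1 / 2) (hby : inner ℝ b y = 1 / 2)
    (hay' : inner ℝ a y' = 1 / 2) (hby' : inner ℝ b y' = 1 / 2) (hne : y' ≠ y) (hne' : y' ≠ a + b - y) :
    inner ℝ y y' = 1 / 2 := by
  rcases E8Frame.pattern_inner_cases h1 h2 hcard ha hb hab hy hy' (Ne.symm hne) hay hby hay' hby' with h | h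
  · exact absurd (E8Frame.pattern_eq_of_inner_zero h1 ha hb hab hy hy' hay hby hay' hby' h) hne'
  · exact h

/-- **Four glue points.** The pattern class contains `y₁, y₂, y₃, y₄` with pairwise inner products `1/2`
(pairwise orthogonal glue components). [cite: ConwaySloane1999, Ch. 14 Thm. 7] -/
theorem exists_four {a b c e d : EuclideanSpace ℝ (Fin 8)} (ha : a ∈ C) (hb : b ∈ C)
    (hc : c ∈ C) (he : e ∈ C) (hd : d ∈ C)
    (hab : inner ℝ a b = 0) (hac : inner ℝ a c = 0) (hae : inner ℝ a e = 0) (hbc : inner ℝ b c = 0)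
    (hbe : inner ℝ b e = 0) (hce : inner ℝ c e = 0) (hdsum : d = (1 / 2 : ℝ) • (a + b + c + e)) :
    ∃ y₁ ∈ C, ∃ y₂ ∈ C, ∃ y₃ ∈ C, ∃ y₄ ∈ C,
      (inner ℝ a y₁ = 1 / 2 ∧ inner ℝ b y₁ = 1 / 2 ∧ inner ℝ c y₁ = 0 ∧ inner ℝ e y₁ = 0) ∧
      (inner ℝ a y₂ = 1 / 2 ∧ inner ℝ b y₂ = 1 / 2 ∧ inner ℝ c y₂ = 0 ∧ inner ℝ e y₂ = 0) ∧
      (inner ℝ a y₃ = 1 / 2 ∧ inner ℝ b y₃ = 1 / 2 ∧ inner ℝ c y₃ = 0 ∧ inner ℝ e y₃ = 0) ∧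
      (inner ℝ a y₄ = 1 / 2 ∧ inner ℝ b y₄ = 1 / 2 ∧ inner ℝ c y₄ = 0 ∧ inner ℝ e y₄ = 0) ∧
      inner ℝ y₁ y₂ = 1 / 2 ∧ inner ℝ y₁ y₃ = 1 / 2 ∧ inner ℝ y₁ y₄ = 1 / 2 ∧
      inner ℝ y₂ y₃ = 1 / 2 ∧ inner ℝ y₂ y₄ = 1 / 2 ∧ inner ℝ y₃ y₄ = 1 / 2 := by
  classical
  set P := C.filter (fun y => inner ℝ a y = 1 / 2 ∧ inner ℝ b y = 1 / 2 ∧ inner ℝ c y = 0 ∧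
      inner ℝ e y = 0) with hP
  have hP8 : 8 ≤ P.card := eight_le_card_pattern h1 h2 hcard ha hb hc he hd hab hac hae hbc hbe hce hdsum
  -- generic step: removing `2k` elements from `P` leaves something when `2k < 8`
  have step : ∀ R : Finset (EuclideanSpace ℝ (Fin 8)), R.card ≤ 6 → ∃ y, y ∈ P \ R := by
    intro R hR
    have h := Finset.le_card_sdiff R P
    have : 0 < (P \ R).card := by omega
    obtain ⟨y, hy⟩ := Finset.card_pos.mp this
    exact ⟨y, hy⟩
  -- y₁
  obtain ⟨y₁, hy₁⟩ := step ∅ (by simp)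
  rw [Finset.sdiff_empty] at hy₁
  have q₁ := Finset.mem_filter.mp hy₁
  -- y₂
  obtain ⟨y₂, hy₂⟩ := step {y₁, a + b - y₁} (Finset.card_le_two.trans (by norm_num))
  rw [Finset.mem_sdiff] at hy₂
  have q₂ := Finset.mem_filter.mp hy₂.1
  have n₂ : y₂ ≠ y₁ ∧ y₂ ≠ a + b - y₁ := by simpa [not_or] using hy₂.2
  -- y₃
  obtain ⟨y₃, hy₃⟩ := step {y₁, a + b - y₁, y₂, a + b - y₂} (Finset.card_le_four.trans (by norm_num))
  rw [Finset.mem_sdiff] at hy₃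
  have q₃ := Finset.mem_filter.mp hy₃.1
  have n₃ : y₃ ≠ y₁ ∧ y₃ ≠ a + b - y₁ ∧ y₃ ≠ y₂ ∧ y₃ ≠ a + b - y₂ := by simpa [not_or] using hy₃.2
  -- y₄
  obtain ⟨y₄, hy₄⟩ := step {y₁, a + b - y₁, y₂, a + b - y₂, y₃, a + b - y₃}
    (Finset.card_le_six.trans (by norm_num))
  rw [Finset.mem_sdiff] at hy₄
  have q₄ := Finset.mem_filter.mp hy₄.1
  have n₄ : y₄ ≠ y₁ ∧ y₄ ≠ a + b - y₁ ∧ y₄ ≠ y₂ ∧ y₄ ≠ a + b - y₂ ∧ y₄ ≠ y₃ ∧ y₄ ≠ a + b - y₃ := by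
    simpa [not_or] using hy₄.2
  refine ⟨y₁, q₁.1, y₂, q₂.1, y₃, q₃.1, y₄, q₄.1, q₁.2, q₂.2, q₃.2, q₄.2, ?_, ?_, ?_, ?_, ?_, ?_⟩
  · exact inner_eq_half_of_ne h1 h2 hcard ha hb hab q₁.1 q₂.1 q₁.2.1 q₁.2.2.1 q₂.2.1 q₂.2.2.1 n₂.1 n₂.2
  · exact inner_eq_half_of_ne h1 h2 hcard ha hb hab q₁.1 q₃.1 q₁.2.1 q₁.2.2.1 q₃.2.1 q₃.2.2.1 n₃.1 n₃.2.1
  · exact inner_eq_half_of_ne h1 h2 hcard ha hb hab q₁.1 q₄.1 q₁.2.1 q₁.2.2.1 q₄.2.1 q₄.2.2.1 n₄.1 n₄.2.1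
  · exact inner_eq_half_of_ne h1 h2 hcard ha hb hab q₂.1 q₃.1 q₂.2.1 q₂.2.2.1 q₃.2.1 q₃.2.2.1 n₃.2.2.1
      n₃.2.2.2
  · exact inner_eq_half_of_ne h1 h2 hcard ha hb hab q₂.1 q₄.1 q₂.2.1 q₂.2.2.1 q₄.2.1 q₄.2.2.1 n₄.2.2.1
      n₄.2.2.2.1
  · exact inner_eq_half_of_ne h1 h2 hcard ha hb hab q₃.1 q₄.1 q₃.2.1 q₃.2.2.1 q₄.2.1 q₄.2.2.1
      n₄.2.2.2.2.1 n₄.2.2.2.2.2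

end config

end Summit.Ventures.PackingBounds.Config.E8Glue
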